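import Summits.ResolutionOfSingularities.ResolutionOfSingularities.Theorems.HilbertSamuelEliminationSigmaMaxModificationsCorridor3WLadderIsoTailsFormalFrameTower
import Summits.ResolutionOfSingularities.ResolutionOfSingularities.Theorems.HilbertSamuelEliminationSigmaMaxModificationsCorridor3WLadderIsoTailsArcPrime
import Summits.ResolutionOfSingularities.ResolutionOfSingularities.Theorems.HilbertSamuelEliminationSigmaMaxModificationsCorridor3WLadderIsoTailsHSArc
import HarnessLib

/-!
# [OURS · L1 W4.2 · D14 «K1 FREE-RATIONAL TAILS»] H∞ AT THE POWER-SERIES LEVEL: a frame tower with initial order `m` makes the closed point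
# of `Spec κ⟦t,y⟧/(g)` NON-ISOLATED in its Hilbert–Samuel locus (D14-BRIDGE-CUT ROUTE H: H6 + arc prime + 001's H7 composed;
# crux `SigmaMaxModifications` stmt-ResolutionOfSingularities-18506 / conjunct stmt-…-19249; kernel `IsoQuadraticTowerTerminates p 3`, card C5 K1)

Lead prover res-L1-w42-lead-1 (gen 4), deal D14 (H6 (c)(d) + H∞ glue). Helper file `--supports stmt-ResolutionOfSingularities-19249 --as helper`;
kernel only, def-free, no named fact. OURS (cell res-hironaka, slot W4.2); NOT statements of [Hironaka2017] nor of [CossartJannsenSaito2020] /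
[CossartPiltant2009]. AI-written; AI review is weaker than expert review.

## What is proved

* **`FormalFrame.not_isIsolatedInHSMaxLocus_of_frameTower`** — rings `R n`, transitions `ι n`, LOCAL frames `ψ n : R n → κ⟦t, y⟧` commuting
  with the transitions up to the translated chart substitutions (constants `c (n+1)`; the output of `FormalFrame.stepFrame`, p523847),
  `ψ n (t n) = t`, strict transforms `ι n (h n) = (t (n+1))^m · h (n+1)`, `m ≥ 1`, and `g := ψ 0 (h 0) ∉ 𝔪^{m+1}` (order EXACTLY `m`) ⟹
  for every `N ≥ 3`, `¬ IsIsolatedInHSMaxLocus (Spec (κ⟦t,y⟧ ⧸ (g))) N (closed point)`.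
  Composition: `FormalFrame.mem_pow_of_frameTower` (p524558: `g ∈ (arc ideal)^m`) + `Series.range_arcFrame` / `isPrime_span_arcFrame` /
  `isRegularLocalRing_quotient_arcFrame` / `ringKrullDim_quotient_arcFrame` (p525893: the arc is a regular curve germ) + res-type-001's H7
  `IsoTailsHS.not_isIsolatedInHSMaxLocus_closedPoint_of_arc` (p521221: Bennett along the arc).

What is left of K1 in the hypersurface cell: the frame tower from the geometric tower (G1a: base frame by Cohen coordinates + the recursion
over res-type-071's H4/H5; res-type-038 / res-type-001) and the isolation transfer `X_{n₀} ⟶ Spec 𝒪 ⟶ Spec κ⟦t,y⟧/(g)` (H8, res-D-pv-010).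

References: idea-1 card C5 (Sketch d9de4647629be5a3); V. Cossart, O. Piltant, J. Algebra 321 (2009) ch. 3 I.9 [CossartPiltant2009];
V. Cossart, U. Jannsen, S. Saito, LNM 2270 (2020) Def. 2.35, Thm. 3.3 [CossartJannsenSaito2020].
-/

noncomputable section

set_option linter.dupNamespace false -- mandated namespace of this single-conjunct summit

open MvPowerSeries IsLocalRing AlgebraicGeometry
open Literature.AlgebraicGeometry.Resolution Literature.AlgebraicGeometry.CossartJannsenSaito2020
open Summit.ResolutionOfSingularities.ResolutionOfSingularities.Theorems.SigmaMaxModificationsCorridor3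

namespace Summit.ResolutionOfSingularities.ResolutionOfSingularities.Cruxes.SigmaMaxModifications.IdeasL1C5

universe u

namespace FormalFrame

variable {κ : Type u} [Field κ]

/-- **D14 H∞ AT THE POWER-SERIES LEVEL.** A tower of formal frames along the strict transforms (`mem_pow_of_frameTower`, p524558) whose
initial equation `g = ψ₀ (h 0)` has ORDER EXACTLY `m ≥ 1` in `κ⟦t, y₁, y₂, y₃⟧` makes the closed point of `Spec κ⟦t,y⟧/(g)` NON-ISOLATED
in its Hilbert–Samuel locus at every level `N ≥ 3` (instance arguments: `isNoetherianRing_mvPowerSeries κ (Fin 4)`,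
`IsoTailsHS.isLocalRing_quotient_span_singleton_of_mem`): the osculating arc `(y_i − Σ_k c_{k,i} t^k)` (prime with regular 1-dimensional quotient,
`Series.isPrime_span_arcFrame` &c., p525893) lies in the multiplicity-`m` locus, and res-type-001's H7
`IsoTailsHS.not_isIsolatedInHSMaxLocus_closedPoint_of_arc` (p521221) applies. What is left of K1 (hypersurface cell) after this: build the
frame tower from the geometric tower (G1a, res-type-038; H4/H5, res-type-071) and transfer isolation from `X_{n₀}` to `Spec κ⟦t,y⟧/(g)`
(H8, res-D-pv-010). [cite: CossartPiltant2009, ch. 3 I.9] [cite: CossartJannsenSaito2020, Def. 2.35, Thm. 3.3] -/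
theorem not_isIsolatedInHSMaxLocus_of_frameTower {R : ℕ → Type u} [∀ n, CommRing (R n)] (ι : ∀ n, R n →+* R (n + 1))
    (ψ : ∀ n, R n →+* MvPowerSeries (Fin 4) κ) (c : ℕ → Fin 4 → κ) (t : ∀ n, R n) (h : ∀ n, R n) {m : ℕ} (hm : 1 ≤ m)
    (hcomm : ∀ n (x : R n), ψ (n + 1) (ι n x) = subst (Series.transChartSubst (c (n + 1))) (ψ n x))
    (ht : ∀ n, ψ n (t n) = X 0)
    (hstrict : ∀ n, ι n (h n) = t (n + 1) ^ m * h (n + 1))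
    (hord : ψ 0 (h 0) ∉ maximalIdeal (MvPowerSeries (Fin 4) κ) ^ (m + 1))
    [IsNoetherianRing (MvPowerSeries (Fin 4) κ)] [IsLocalRing (MvPowerSeries (Fin 4) κ ⧸ Ideal.span {ψ 0 (h 0)})]
    {N : ℕ} (hN : 3 ≤ N) :
    ¬ IsIsolatedInHSMaxLocus (Spec (CommRingCat.of (MvPowerSeries (Fin 4) κ ⧸ Ideal.span {ψ 0 (h 0)}))) N
        (closedPoint (MvPowerSeries (Fin 4) κ ⧸ Ideal.span {ψ 0 (h 0)})) := by
  haveI := isRegularLocalRing_mvPowerSeries κ (Fin 4)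
  have hmem := mem_pow_of_frameTower ι ψ c t h m hcomm ht hstrict
  rw [← Series.range_arcFrame] at hmem
  haveI := Series.isPrime_span_arcFrame (K := κ) c
  haveI := Series.isRegularLocalRing_quotient_arcFrame (K := κ) c
  have hd : ringKrullDim (MvPowerSeries (Fin 4) κ) = ((3 + 1 : ℕ) : WithBot ℕ∞) := by
    rw [ringKrullDim_mvPowerSeries, Nat.card_eq_fintype_card, Fintype.card_fin]
  exact IsoTailsHS.not_isIsolatedInHSMaxLocus_closedPoint_of_arc hd (Ideal.span (Set.range (Series.arcFrame c)))
    (Series.ringKrullDim_quotient_arcFrame c) hm hmem hord hN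

end FormalFrame

end Summit.ResolutionOfSingularities.ResolutionOfSingularities.Cruxes.SigmaMaxModifications.IdeasL1C5

end
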